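import Summits.RiemannHypothesis.RiemannHypothesis.Theorems.GroundBartaPolarPerronFrobeniusEvenSectorNegativity
import Summits.RiemannHypothesis.RiemannHypothesis.Theorems.OddSectorOddNegativityOffLine
import Summits.RiemannHypothesis.RiemannHypothesis.Theorems.RuelleBandExactFirstBandStubEvenOddDecomposition
import Summits.RiemannHypothesis.RiemannHypothesis.Theorems.PfPersistenceM2EvenSectorIndexBound
import Literature.NumberTheory.LFunctions.WeilCriterionProofs
import HarnessLib

/-!
# PF persistence, M2 seat (pub-rhpf, gen 5, part 4): the SECOND level of the FULL real window Weil form IS an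
RH detector — in contrast with the even sector

HONEST FRAMING (page 1 of everything in this cell): long-odds MECHANISM SEARCH; no RH claims.  Every statement
in this file is RH-free bookkeeping about Weil's quadratic functional `Q = weilQuadratic` (the untruncated form
of `ζ`) on REAL-valued test functions, assembled from theorems already in the tree.

## What is proved

* `weilQuadratic_even_add_odd` — for an even real Weil test `g₁`, an odd real Weil test `g₂` and real
  `c₁, c₂`: `Q(c₁ g₁ + c₂ g₂) = c₁² Q(g₁) + c₂² Q(g₂)` (the involution `t ↦ -t` makes the two parity sectors
  `Q`-orthogonal; tree: `RuelleBandExactFirstBand.stub_evenOddDecomposition`).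
* **`exists_negative_definite_even_odd_pair_of_not_riemannHypothesis`** — if RH fails, there are a window `A`,
  an even real Weil test `g₁` and an odd real Weil test `g₂`, both supported in `[-A, A]`, such that
  `Re Q(c₁ g₁ + c₂ g₂) < 0` for every real `(c₁, c₂) ≠ (0, 0)`: the full REAL Weil form has TWO independent
  negative directions at every window `a ≥ A` (tree: the even witness
  `PolarPerronFrobenius.evenNegativity_exists_even_real_neg` and Yoshida's odd witness
  `oddNegativityOffLine_exists_odd_real_neg`, both contrapositives of in-tree sector criteria).  NO finiteness
  hypothesis on the off-line zeros is needed (contrast: part 2 of this packet needs `K < ∞` to produce a SECOND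
  EVEN direction, and one off-line quadruple never produces one, gen 4).
* `exists_negative_definite_real_pair_of_not_riemannHypothesis` — the same in `Fin 2`-family form, window-uniform.
* **`riemannHypothesis_iff_forall_real_pair_exists_nonneg`** — RH ⟺ every real 2-plane of real Weil tests
  contains a non-zero vector with `Re Q ≥ 0` ("the second level of the full real Weil form is `≥ 0` at every
  window").  So, for the FULL real form, level 2 is exactly as strong as level 1 (Weil's criterion,
  `weil_criterion_holds`); for the EVEN form level 2 only detects `K ≥ 2` off-line quadruples (parts 2–3,
  `not_evenNegIndexAtLeast_two_iff`).  Bombieri's count for finite truncations (Thm 8: the full matrix has one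
  negative eigenvalue per conjugate PAIR of off-line `γ`, i.e. `2K` for `ζ`; Thm 9: `K` in each parity sector) is
  the in-print form of this contrast.

The M2 seat's typed gap law `PfPersistenceM2Laws.IsGapConstant` / `GapLaw` is stated over ALL window tests against
the full ground energy; this file is what decides how its "second level" reads off RH (see HOME/M2-ROUTE.md §11).

References: E. Bombieri, *Remarks on Weil's quadratic functional in the theory of prime numbers, I*, Rend. Mat.
Acc. Lincei (9) 11 (2000) 183–233, Thm 8, Thm 9 [Bombieri2000Weil]; H. Yoshida, *On Hermitian forms attached to
zeta functions*, Invent. Math. 110 (1992), Prop. 1 [Yoshida1992HermitianForms].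
-/

-- the problem directory `RiemannHypothesis/RiemannHypothesis` fixes the namespace (gate convention)
set_option linter.dupNamespace false

noncomputable section

open Complex Filter Set MeasureTheory
open scoped Real Topology ComplexConjugate BigOperators

namespace Summit.RiemannHypothesis.RiemannHypothesis.Theorems.PfPersistenceM2NegIndex

open Literature.NumberTheory.LFunctions
open Summit.RiemannHypothesis.RiemannHypothesis.Theorems.PolarPerronFrobenius
  (evenNegativity_exists_even_real_neg)
open Summit.RiemannHypothesis.RiemannHypothesis.Theorems.RuelleBandExactFirstBand
  (stub_evenOddDecomposition)

/-! ## A. Parity sectors are `Q`-orthogonal -/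

/-- For an even real Weil test `g₁`, an odd real Weil test `g₂` and real scalars:
`Q(c₁ g₁ + c₂ g₂) = c₁² Q(g₁) + c₂² Q(g₂)`.  (The even part of `c₁ g₁ + c₂ g₂` is `c₁ g₁`, its odd part is
`c₂ g₂`; apply the tree's `Q = Q(even part) + Q(odd part)` for real tests and `Q(c g) = |c|² Q(g)`.)
[cite: Bombieri2000Weil, §7 (even/odd splitting of the kernel)] -/
theorem weilQuadratic_even_add_odd {g₁ g₂ : ℝ → ℂ} (h₁ : IsWeilTest g₁) (h₂ : IsWeilTest g₂)
    (he : ∀ t : ℝ, g₁ (-t) = g₁ t) (ho : ∀ t : ℝ, g₂ (-t) = -g₂ t) (hr₁ : ∀ t : ℝ, (g₁ t).im = 0)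
    (hr₂ : ∀ t : ℝ, (g₂ t).im = 0) (c₁ c₂ : ℝ) :
    weilQuadratic (fun t : ℝ ↦ (c₁ : ℂ) * g₁ t + (c₂ : ℂ) * g₂ t) =
      ((c₁ ^ 2 : ℝ) : ℂ) * weilQuadratic g₁ + ((c₂ ^ 2 : ℝ) : ℂ) * weilQuadratic g₂ := by
  have hG : IsWeilTest fun t : ℝ ↦ (c₁ : ℂ) * g₁ t + (c₂ : ℂ) * g₂ t :=
    (h₁.const_mul (c₁ : ℂ)).add (h₂.const_mul (c₂ : ℂ))
  have hGr : ∀ t : ℝ, ((c₁ : ℂ) * g₁ t + (c₂ : ℂ) * g₂ t).im = 0 := fun t ↦ by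
    simp only [Complex.add_im, Complex.im_ofReal_mul, hr₁ t, hr₂ t, mul_zero, add_zero]
  have hdec := stub_evenOddDecomposition _ hG hGr
  have he' : (fun t : ℝ ↦ (((c₁ : ℂ) * g₁ t + (c₂ : ℂ) * g₂ t) +
      ((c₁ : ℂ) * g₁ (-t) + (c₂ : ℂ) * g₂ (-t))) / 2) = fun t : ℝ ↦ (c₁ : ℂ) * g₁ t := by
    funext t
    rw [he t, ho t]
    ring
  have ho' : (fun t : ℝ ↦ (((c₁ : ℂ) * g₁ t + (c₂ : ℂ) * g₂ t) -
      ((c₁ : ℂ) * g₁ (-t) + (c₂ : ℂ) * g₂ (-t))) / 2) = fun t : ℝ ↦ (c₂ : ℂ) * g₂ t := by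
    funext t
    rw [he t, ho t]
    ring
  rw [hdec, he', ho', weilQuadratic_const_mul, weilQuadratic_const_mul, Complex.normSq_ofReal,
    Complex.normSq_ofReal, sq, sq]

/-- Real part of the previous identity: `Re Q(c₁ g₁ + c₂ g₂) = c₁² Re Q(g₁) + c₂² Re Q(g₂)`. [folklore] -/
theorem re_weilQuadratic_even_add_odd {g₁ g₂ : ℝ → ℂ} (h₁ : IsWeilTest g₁) (h₂ : IsWeilTest g₂)
    (he : ∀ t : ℝ, g₁ (-t) = g₁ t) (ho : ∀ t : ℝ, g₂ (-t) = -g₂ t) (hr₁ : ∀ t : ℝ, (g₁ t).im = 0)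
    (hr₂ : ∀ t : ℝ, (g₂ t).im = 0) (c₁ c₂ : ℝ) :
    (weilQuadratic (fun t : ℝ ↦ (c₁ : ℂ) * g₁ t + (c₂ : ℂ) * g₂ t)).re =
      c₁ ^ 2 * (weilQuadratic g₁).re + c₂ ^ 2 * (weilQuadratic g₂).re := by
  rw [weilQuadratic_even_add_odd h₁ h₂ he ho hr₁ hr₂, Complex.add_re, Complex.re_ofReal_mul,
    Complex.re_ofReal_mul]

/-! ## B. Off RH the full real form has two negative directions (no finiteness hypothesis) -/

/-- A compactly supported function lives in some window `[-A, A]`. [folklore] -/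
theorem exists_tsupport_subset_Icc {g : ℝ → ℂ} (hg : HasCompactSupport g) :
    ∃ A : ℝ, tsupport g ⊆ Icc (-A) A := by
  obtain ⟨r, hr⟩ := hg.isCompact.isBounded.subset_closedBall (0 : ℝ)
  refine ⟨r, ?_⟩
  rwa [Real.closedBall_eq_Icc, zero_sub, zero_add] at hr

/-- **Two negative directions of the full real Weil form off RH.**  If the Riemann hypothesis fails, there are
a window `A`, an EVEN real Weil test `g₁` and an ODD real Weil test `g₂`, both supported in `[-A, A]`, with
`Re Q(c₁ g₁ + c₂ g₂) < 0` for every real `(c₁, c₂) ≠ (0, 0)`.  The even direction is the contrapositive of the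
in-tree even Weil criterion, the odd one Yoshida's odd criterion (in-tree, one-sided Landau engine); the sectors
are `Q`-orthogonal (`weilQuadratic_even_add_odd`).  No hypothesis on the number of off-line zeros.
[cite: Bombieri2000Weil, Thm 8; Yoshida1992HermitianForms, Prop. 1] -/
theorem exists_negative_definite_even_odd_pair_of_not_riemannHypothesis (hRH : ¬ RiemannHypothesis) :
    ∃ A : ℝ, ∃ g₁ g₂ : ℝ → ℂ, IsWeilTest g₁ ∧ IsWeilTest g₂ ∧ (∀ t : ℝ, g₁ (-t) = g₁ t) ∧
      (∀ t : ℝ, g₂ (-t) = -g₂ t) ∧ (∀ t : ℝ, (g₁ t).im = 0) ∧ (∀ t : ℝ, (g₂ t).im = 0) ∧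
      tsupport g₁ ⊆ Icc (-A) A ∧ tsupport g₂ ⊆ Icc (-A) A ∧
      ∀ c₁ c₂ : ℝ, (c₁ ≠ 0 ∨ c₂ ≠ 0) →
        (weilQuadratic (fun t : ℝ ↦ (c₁ : ℂ) * g₁ t + (c₂ : ℂ) * g₂ t)).re < 0 := by
  obtain ⟨g₁, h₁, he, hr₁, hneg₁⟩ := evenNegativity_exists_even_real_neg hRH
  obtain ⟨g₂, h₂, ho, hr₂, hneg₂⟩ := oddNegativityOffLine_exists_odd_real_neg hRH
  obtain ⟨A₁, hA₁⟩ := exists_tsupport_subset_Icc h₁.2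
  obtain ⟨A₂, hA₂⟩ := exists_tsupport_subset_Icc h₂.2
  refine ⟨max A₁ A₂, g₁, g₂, h₁, h₂, he, ho, hr₁, hr₂,
    hA₁.trans (Icc_subset_Icc (neg_le_neg (le_max_left _ _)) (le_max_left _ _)),
    hA₂.trans (Icc_subset_Icc (neg_le_neg (le_max_right _ _)) (le_max_right _ _)), fun c₁ c₂ hc ↦ ?_⟩
  rw [re_weilQuadratic_even_add_odd h₁ h₂ he ho hr₁ hr₂]
  rcases hc with hc | hc
  · exact add_neg_of_neg_of_nonpos (mul_neg_of_pos_of_neg (by positivity) hneg₁)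
      (mul_nonpos_of_nonneg_of_nonpos (sq_nonneg _) hneg₂.le)
  · exact add_neg_of_nonpos_of_neg (mul_nonpos_of_nonneg_of_nonpos (sq_nonneg _) hneg₁.le)
      (mul_neg_of_pos_of_neg (by positivity) hneg₂)

/-- **`Fin 2`-family, window-uniform form.**  Off RH there is `A` such that EVERY window `a ≥ A` carries two
real Weil tests on whose real span (minus `0`) `Re Q < 0` — the full real window form has negative index `≥ 2`
on all long windows.  [cite: Bombieri2000Weil, Thm 8; Yoshida1992HermitianForms, Prop. 1] -/
theorem exists_negative_definite_real_pair_of_not_riemannHypothesis (hRH : ¬ RiemannHypothesis) :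
    ∃ A : ℝ, ∀ a : ℝ, A ≤ a → ∃ g : Fin 2 → ℝ → ℂ, (∀ i, IsWeilTest (g i)) ∧
      (∀ i (t : ℝ), (g i t).im = 0) ∧ (∀ i, tsupport (g i) ⊆ Icc (-a) a) ∧
      ∀ c : Fin 2 → ℝ, c ≠ 0 → (weilQuadratic (fun t : ℝ ↦ ∑ i, (c i : ℂ) * g i t)).re < 0 := by
  obtain ⟨A, g₁, g₂, h₁, h₂, he, ho, hr₁, hr₂, hA₁, hA₂, hneg⟩ :=
    exists_negative_definite_even_odd_pair_of_not_riemannHypothesis hRH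
  refine ⟨A, fun a ha ↦ ⟨![g₁, g₂], ?_, ?_, ?_, fun c hc ↦ ?_⟩⟩
  · intro i
    fin_cases i
    · exact h₁
    · exact h₂
  · intro i t
    fin_cases i
    · exact hr₁ t
    · exact hr₂ t
  · intro i
    fin_cases i
    · exact hA₁.trans (Icc_subset_Icc (neg_le_neg ha) ha)
    · exact hA₂.trans (Icc_subset_Icc (neg_le_neg ha) ha)
  · have hc' : c 0 ≠ 0 ∨ c 1 ≠ 0 := by
      by_contra h
      push Not at h
      apply hc
      funext i
      fin_cases i
      · exact h.1
      · exact h.2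
    have e : (fun t : ℝ ↦ ∑ i, (c i : ℂ) * (![g₁, g₂] : Fin 2 → ℝ → ℂ) i t) =
        fun t : ℝ ↦ (c 0 : ℂ) * g₁ t + (c 1 : ℂ) * g₂ t := by
      funext t
      simp [Fin.sum_univ_two]
    rw [e]
    exact hneg (c 0) (c 1) hc'

/-! ## C. The second level of the full real form is RH-equivalent -/

/-- **RH ⟺ "every real 2-plane of real Weil tests contains a non-zero vector with `Re Q ≥ 0`"** (the second
level of the full real Weil form is non-negative at every window).  `→`: Weil positivity under RH
(`weil_criterion_holds`).  `←`: the two negative directions of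
`exists_negative_definite_real_pair_of_not_riemannHypothesis`.  Contrast (parts 2–3 of this packet): in the
EVEN sector the same second-level statement is equivalent, under finitely many off-line zeros, to "at most ONE
off-line quadruple" — NOT to RH. [cite: Bombieri2000Weil, Thm 2, Thm 8, Thm 9] -/
theorem riemannHypothesis_iff_forall_real_pair_exists_nonneg :
    RiemannHypothesis ↔ ∀ g : Fin 2 → ℝ → ℂ, (∀ i, IsWeilTest (g i)) → (∀ i (t : ℝ), (g i t).im = 0) →
      ∃ c : Fin 2 → ℝ, c ≠ 0 ∧ 0 ≤ (weilQuadratic (fun t : ℝ ↦ ∑ i, (c i : ℂ) * g i t)).re := by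
  constructor
  · intro hRH g hg _
    have hpos : WeilPositivity := weil_criterion_holds.1 hRH
    refine ⟨Pi.single 0 1, ?_, hpos _ (isWeilTest_finset_sum _ fun i _ ↦ (hg i).const_mul _)⟩
    intro h
    have := congrFun h 0
    simp at this
  · intro H
    by_contra hRH
    obtain ⟨A, hA⟩ := exists_negative_definite_real_pair_of_not_riemannHypothesis hRH
    obtain ⟨g, hg, hr, -, hneg⟩ := hA A le_rfl
    obtain ⟨c, hc, hnn⟩ := H g hg hr
    exact absurd (hneg c hc) (not_lt.2 hnn)

/-- Window-uniform reading of the same equivalence: RH fails iff SOME window carries two real Weil tests spanning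
a negative-definite real 2-plane of the full Weil form. [cite: Bombieri2000Weil, Thm 8] -/
theorem not_riemannHypothesis_iff_exists_negative_definite_real_pair :
    ¬ RiemannHypothesis ↔ ∃ a : ℝ, ∃ g : Fin 2 → ℝ → ℂ, (∀ i, IsWeilTest (g i)) ∧
      (∀ i (t : ℝ), (g i t).im = 0) ∧ (∀ i, tsupport (g i) ⊆ Icc (-a) a) ∧
      ∀ c : Fin 2 → ℝ, c ≠ 0 → (weilQuadratic (fun t : ℝ ↦ ∑ i, (c i : ℂ) * g i t)).re < 0 := by
  constructor
  · intro hRH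
    obtain ⟨A, hA⟩ := exists_negative_definite_real_pair_of_not_riemannHypothesis hRH
    exact ⟨A, hA A le_rfl⟩
  · rintro ⟨a, g, hg, hr, -, hneg⟩ hRH
    obtain ⟨c, hc, hnn⟩ := riemannHypothesis_iff_forall_real_pair_exists_nonneg.1 hRH g hg hr
    exact absurd (hneg c hc) (not_lt.2 hnn)

end Summit.RiemannHypothesis.RiemannHypothesis.Theorems.PfPersistenceM2NegIndex

end
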